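import Literature.Analysis.FluidPDE.PeriodicCylinderNeumannInterior
import Literature.Analysis.FluidPDE.PeriodicCylinderNeumannMultiPeriod
import Literature.Analysis.FunctionSpaces.SobolevDomainGluing
import Literature.Analysis.FunctionSpaces.SobolevNormSmoothMaps
import HarnessLib

/-!
# The weak Neumann potential on the periodic cylinder is smooth up to the wall

Topic `Literature/Analysis/FluidPDE`. Theorem-only file (no definitions, no named facts); the
qualitative conclusion of the regularity theory for the weak periodic Neumann problem on the
cylinder `{r ≤ 1} × ℝ/Lℤ` (`PeriodicCylinderHelmholtz` … `PeriodicCylinderNeumannInterior`; the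
analytic input of the local existence theorem for the Euler equations in the periodic cylinder,
T. Kato, C. Y. Lai, J. Funct. Anal. **56** (1984), Thm I/II, named fact
`Literature.Analysis.FluidPDE.KatoLai1984_periodicCylinderUniformExistence`; regularity of the
Neumann problem "by standard elliptic theory", Kato–Lai §4 (i) and [14, Thm 5.5.2]).

For smooth `L`-periodic data `h₀, h₁` (`∫_cell h₀ = 0`) let `∇q = ∇q[h₀,h₁] ∈ 𝓖` be the weak
Neumann solution and `q` its potential on the period cell.

* `memSobolevDomain_potential_cell` — **`q ∈ W^{k,2}(cell)` for every `k`**: on the interior piece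
  `cell ∩ {r < 0.65}` from the smooth representative on the tube `{r < 0.7} × ℝ`
  (`exists_tube_smooth_rep`, `memSobolevDomain_of_contDiffOn`), on the annulus `cell ∩ {ρ > 1/4}`
  (a wall piece) from `memSobolevDomain_potential_neumannGrad`, glued by a radial cut-off
  (`MemSobolevDomain.glue`);
* `exists_smooth_rep_potential_cell` — hence (`⋂ₖ W^{k,2} ⊂ C^∞` up to the boundary of the convex
  cell, `exists_contDiffOn_closure_of_forall_memSobolevDomain`) `q` agrees a.e. on the cell with a
  continuous function, `C^∞` on the closed cell;
* `subset_closure_slabCylinder`, `axialRed_eq_sub_of_mem_slab_int`, `ae_comp_axialRed_of_ae_cell` —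
  geometry and measure theory of the periodic extension (closed slabs of the closed cylinder lie in
  the closure of the open ones; the axial reduction on a slab is a translation; a.e. statements on
  the cell pass to `p ∘ axialRed` a.e. on the infinite cylinder);
* `exists_isSmoothPeriodic_potential` — **the smooth periodic representative**: there is `q̂` with
  `IsSmoothPeriodic L q̂` (smooth on the closed cylinder `{r ≤ 1}`, `L`-periodic), `q = q̂` a.e. on
  the cell and `∇q = ∇_K q̂ = cylGrad q̂` a.e. on the cell. `q̂ = f₀ ∘ axialRed` for the representative
  `f₀` of the previous item; at the seams `z ∈ Lℤ` it coincides, on a neighbourhood within the closed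
  cylinder, with a translate of the representative `f₁` for the data shifted by half a period
  (covariance `potential_shiftedData_ae_eq`; continuous representatives a.e. equal on an open set
  agree on its closure), which is smooth across the seam.

Mathlib/tree search: tree `isLipschitzDomain_cylinderCell`, `isCompact_closure_cylinderCell`,
`closure_unitCylinder`, `closure_unitCylinder_mem_nhds`, `volume_setOf_apply_two_eq`,
`IsAxiallyPeriodic.add_int_mul_smul_eZ`, `inner_cylGrad_right`; Mathlib `Int.floor_eq_iff`,
`mem_closure_of_tendsto`, `Set.EqOn.closure`, `contDiffWithinAt_inter`,
`ContDiffWithinAt.congr_of_eventuallyEq`, `Opens.mem_sup`/`Opens.mem_inf`.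

## References

* T. Kato, C. Y. Lai, J. Funct. Anal. 56 (1984) 15–28, §4 (i), §5. [KatoLai1984]
* L. C. Evans, *Partial Differential Equations*, 2nd ed. (2010), §6.3. [Evans2010]
-/

noncomputable section

open MeasureTheory Set Function Filter Topology TopologicalSpace WithLp Metric Module
open scoped ContDiff NNReal ENNReal InnerProductSpace RealInnerProductSpace

namespace Literature.Analysis.FluidPDE

open Literature.Analysis.FunctionSpaces

/-- Local notation for physical space `ℝ³ = EuclideanSpace ℝ (Fin 3)`. -/
local notation "ℝ³" => EuclideanSpace ℝ (Fin 3)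

/-- Local notation for the closed unit cylinder `{r ≤ 1}`. -/
local notation "𝕂" => closure (SetLike.coe unitCylinder : Set (EuclideanSpace ℝ (Fin 3)))

namespace PeriodicCylinder

variable {L : ℝ}

/-! ### Sobolev regularity of every order on the cell -/

/-- **The potential lies in `W^{k,2}(cell)` for every `k`** (interior piece from the smooth tube
representative, annular piece from the wall-piece regularity, glued by a radial cut-off). [folklore] -/
theorem memSobolevDomain_potential_cell (hL : 0 < L) {h₀ : ℝ³ → ℝ} {h₁ : ℝ³ → ℝ³}
    (hh₀ : IsSmoothPeriodic L h₀) (hh₁ : IsSmoothPeriodic L h₁)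
    (hmean : ∫ x in (cylinderCell L : Set ℝ³), h₀ x = 0) (k : ℕ) :
    MemSobolevDomain k 2 (cylinderCell L) volume
      ((potential (neumannGrad L (toCell L h₀) (toCell L h₁)) : Lp ℝ 2 (cellMeasure L)) : ℝ³ → ℝ) := by
  set q : ℝ³ → ℝ := ((potential (neumannGrad L (toCell L h₀) (toCell L h₁)) : Lp ℝ 2 (cellMeasure L)) : ℝ³ → ℝ)
    with hq
  obtain ⟨qI, hqIs, -, hQqI, -⟩ := exists_tube_smooth_rep hL hh₀ hh₁ hmean
  have hTo : IsOpen {x : ℝ³ | cylRadius x < 0.7} := isOpen_lt continuous_cylRadius continuous_const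
  have hρc : Continuous fun x : ℝ³ => ‖horizontalProj x‖ ^ 2 := (contDiff_horizontalProj.continuous.norm).pow 2
  set I : Opens ℝ³ := cylinderCell L ⊓ ⟨{x : ℝ³ | cylRadius x < 0.65}, isOpen_lt continuous_cylRadius continuous_const⟩
    with hI
  set A : Opens ℝ³ := cylinderCell L ⊓ ⟨{x : ℝ³ | (1 : ℝ) / 4 < ‖horizontalProj x‖ ^ 2}, isOpen_lt continuous_const hρc⟩
    with hA
  have hIcoe : (I : Set ℝ³) = (cylinderCell L : Set ℝ³) ∩ {x : ℝ³ | cylRadius x < 0.65} := by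
    rw [hI, Opens.coe_inf]; rfl
  have hAcoe : (A : Set ℝ³) = (cylinderCell L : Set ℝ³) ∩ {x : ℝ³ | (1 : ℝ) / 4 < ‖horizontalProj x‖ ^ 2} := by
    rw [hA, Opens.coe_inf]; rfl
  -- the interior piece
  have hIT : (I : Set ℝ³) ⊆ {x : ℝ³ | cylRadius x < 0.7} := by
    rw [hIcoe]
    exact fun x hx => show cylRadius x < 0.7 from lt_trans (show cylRadius x < 0.65 from hx.2) (by norm_num)
  have hIcl : closure (I : Set ℝ³) ⊆ {x : ℝ³ | cylRadius x < 0.7} := by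
    rw [hIcoe]
    refine (closure_mono inter_subset_right).trans ?_
    refine (closure_lt_subset_le continuous_cylRadius continuous_const).trans fun x hx => ?_
    exact show cylRadius x < 0.7 from lt_of_le_of_lt (show cylRadius x ≤ 0.65 from hx) (by norm_num)
  have hIcpt : IsCompact (closure (I : Set ℝ³)) :=
    (isCompact_closure_cylinderCell (L := L)).of_isClosed_subset isClosed_closure (closure_mono (by
      rw [hIcoe]; exact inter_subset_left))
  have hImem : MemSobolevDomain k 2 I volume qI :=
    memSobolevDomain_of_contDiffOn hTo.uniqueDiffOn hIcpt hIcl 2 k hqIs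
  have hIq : qI =ᵐ[volume.restrict (I : Set ℝ³)] q := by
    have h1 : ∀ᵐ x ∂(volume.restrict (I : Set ℝ³)), _ := ae_restrict_of_ae_restrict_of_subset hIT hQqI
    have h2 : ∀ᵐ x ∂(volume.restrict (I : Set ℝ³)), x ∈ (I : Set ℝ³) := ae_restrict_mem I.isOpen.measurableSet
    filter_upwards [h1, h2] with x hx1 hx2
    rw [hIcoe] at hx2
    rw [← hx1, hq, axialRed_eq_self_of_mem_cell hL hx2.1]
  have hI' : MemSobolevDomain k 2 I volume q := hImem.congr_ae hIq
  -- the annular piece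
  have hAw : IsWallPiece L A := ⟨inf_le_left, fun x hx => by rw [hAcoe] at hx; exact hx.2⟩
  have hA' : MemSobolevDomain k 2 A volume q := memSobolevDomain_potential_neumannGrad hL hAw hh₀ hh₁ hmean k
  -- the gluing cut-off
  obtain ⟨χ, hχs, -, hχ1, hχ0⟩ := exists_cylindrical_cutoff (a := 0.55) (b := 0.6) (by norm_num) (by norm_num)
  have hmem_cell : ∀ x : ℝ³, x ∈ ((I ⊔ A : Opens ℝ³) : Set ℝ³) → x ∈ (cylinderCell L : Set ℝ³) := fun x hx => by
    have hx' : x ∈ I ⊔ A := hx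
    rcases Opens.mem_sup.1 hx' with h | h
    · have : x ∈ (I : Set ℝ³) := h
      rw [hIcoe] at this; exact this.1
    · have : x ∈ (A : Set ℝ³) := h
      rw [hAcoe] at this; exact this.1
  have hχg : IsGluingCutoff I A χ := by
    refine ⟨hχs, ?_, ?_⟩
    · rintro x ⟨hx, hxχ⟩
      have hr : cylRadius x ≤ 0.6 := by
        by_contra h
        have : x ∉ tsupport χ := by
          rw [notMem_tsupport_iff_eventuallyEq]
          filter_upwards [(isOpen_lt continuous_const continuous_cylRadius).mem_nhds (not_le.1 h)] with y hy
          exact hχ0 y hy.le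
        exact this hxχ
      show x ∈ (I : Set ℝ³)
      rw [hIcoe]
      exact ⟨hmem_cell x hx, show cylRadius x < 0.65 by linarith⟩
    · rintro x ⟨hx, hxχ⟩
      have hr : 0.55 ≤ cylRadius x := by
        by_contra h
        have : x ∉ tsupport (fun y => 1 - χ y) := by
          rw [notMem_tsupport_iff_eventuallyEq]
          filter_upwards [(isOpen_lt continuous_cylRadius continuous_const).mem_nhds (not_le.1 h)] with y hy
          simp [hχ1 y hy.le]
        exact this hxχ
      show x ∈ (A : Set ℝ³)
      rw [hAcoe]
      refine ⟨hmem_cell x hx, ?_⟩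
      show (1 : ℝ) / 4 < ‖horizontalProj x‖ ^ 2
      rw [norm_horizontalProj]
      nlinarith
  have hglue := MemSobolevDomain.glue hχg (μ := volume) (p := 2) k hI' hA'
  have hIA : I ⊔ A = cylinderCell L := by
    apply le_antisymm (sup_le inf_le_left inf_le_left)
    intro x hx
    by_cases h : cylRadius x < 0.65
    · exact Opens.mem_sup.2 (Or.inl (show x ∈ (I : Set ℝ³) by rw [hIcoe]; exact ⟨hx, h⟩))
    · refine Opens.mem_sup.2 (Or.inr (show x ∈ (A : Set ℝ³) by
        rw [hAcoe]
        refine ⟨hx, ?_⟩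
        show (1 : ℝ) / 4 < ‖horizontalProj x‖ ^ 2
        rw [norm_horizontalProj]
        nlinarith [not_lt.1 h]))
  rw [hIA] at hglue
  exact hglue

/-- **A representative of the potential smooth on the closed cell**: `q` agrees a.e. on the cell
with a continuous function, `C^∞` on `closure cell` (and equal there, for every `m`, to a globally
`C^m` function). [folklore] -/
theorem exists_smooth_rep_potential_cell (hL : 0 < L) {h₀ : ℝ³ → ℝ} {h₁ : ℝ³ → ℝ³}
    (hh₀ : IsSmoothPeriodic L h₀) (hh₁ : IsSmoothPeriodic L h₁)
    (hmean : ∫ x in (cylinderCell L : Set ℝ³), h₀ x = 0) :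
    ∃ f : ℝ³ → ℝ, Continuous f ∧ ContDiffOn ℝ ∞ f (closure (cylinderCell L : Set ℝ³)) ∧
      (((potential (neumannGrad L (toCell L h₀) (toCell L h₁)) : Lp ℝ 2 (cellMeasure L)) : ℝ³ → ℝ) =ᵐ[
        cellMeasure L] f) ∧
      ∀ m : ℕ, ∃ g : ℝ³ → ℝ, ContDiff ℝ m g ∧ EqOn f g (closure (cylinderCell L : Set ℝ³)) := by
  have hk := fun k => memSobolevDomain_potential_cell hL hh₀ hh₁ hmean k
  obtain ⟨f, hf, hfc, hfs, hreps⟩ := exists_contDiffOn_closure_of_forall_memSobolevDomain (μ := volume)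
    (F := ℝ) finrank_euclideanSpace_fin (isLipschitzDomain_cylinderCell L) (isBounded_cylinderCell L) hk
  exact ⟨f, hfc, hfs, hf, hreps⟩

/-! ### Geometry and measure theory of the periodic extension -/

/-- **Closed slabs of the closed cylinder lie in the closure of the open ones**: for `α < β`,
`{r ≤ 1} × [α, β] ⊆ closure ({r < 1} × (α, β))` (every point is the endpoint of the segment from
`(0, 0, (α+β)/2)`, whose other points are inside). [folklore] -/
theorem subset_closure_slabCylinder {α β : ℝ} (hαβ : α < β) :
    {x : ℝ³ | cylRadius x ≤ 1 ∧ x 2 ∈ Icc α β} ⊆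
      closure {x : ℝ³ | cylRadius x < 1 ∧ α < x 2 ∧ x 2 < β} := by
  rintro x ⟨hr, hz⟩
  set c : ℝ³ := ((α + β) / 2) • EuclideanSpace.single (2 : Fin 3) (1 : ℝ) with hc
  set p : ℝ → ℝ³ := fun t => c + t • (x - c) with hp
  have hp1 : p 1 = x := by simp [hp]
  have hcont : Continuous p := by fun_prop
  have hmem : ∀ t ∈ Ioo (0 : ℝ) 1, p t ∈ {x : ℝ³ | cylRadius x < 1 ∧ α < x 2 ∧ x 2 < β} := by
    intro t ht
    have hc2 : c 2 = (α + β) / 2 := by simp [hc]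
    have hhp : horizontalProj (p t) = t • horizontalProj x := by
      have hc0 : horizontalProj c = 0 := by
        have h := horizontalProj_add_axialShift (0 : ℝ³) ((α + β) / 2)
        rw [zero_add, map_zero] at h
        exact h
      simp only [hp, map_add, map_smul, map_sub, hc0, sub_zero, zero_add]
    have hp2 : p t 2 = (α + β) / 2 + t * (x 2 - (α + β) / 2) := by simp [hp, hc2]
    refine ⟨?_, ?_, ?_⟩
    · rw [← norm_horizontalProj, hhp, norm_smul, Real.norm_eq_abs, abs_of_pos ht.1, norm_horizontalProj]
      calc t * cylRadius x ≤ t * 1 := mul_le_mul_of_nonneg_left hr ht.1.le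
        _ < 1 := by rw [mul_one]; exact ht.2
    · rw [hp2]; nlinarith [hz.1, hz.2, ht.1, ht.2]
    · rw [hp2]; nlinarith [hz.1, hz.2, ht.1, ht.2]
  have htend : Tendsto p (𝓝[<] (1 : ℝ)) (𝓝 x) := by
    rw [← hp1]; exact (hcont.tendsto 1).mono_left nhdsWithin_le_nhds
  refine mem_closure_of_tendsto htend ?_
  filter_upwards [Ioo_mem_nhdsLT (zero_lt_one' ℝ)] with t ht using hmem t ht

/-- The closed cell `{r ≤ 1} × [0, L]` lies in `closure cell` (`L > 0`). [folklore] -/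
theorem subset_closure_cylinderCell' (hL : 0 < L) :
    {x : ℝ³ | cylRadius x ≤ 1 ∧ x 2 ∈ Icc 0 L} ⊆ closure (cylinderCell L : Set ℝ³) := by
  have h := subset_closure_slabCylinder (α := 0) (β := L) hL
  have e : {x : ℝ³ | cylRadius x < 1 ∧ 0 < x 2 ∧ x 2 < L} = (cylinderCell L : Set ℝ³) := by
    ext x; rw [SetLike.mem_coe, mem_cylinderCell]; rfl
  rwa [e] at h

/-- **The axial reduction on an integer slab is a translation**: if `nL ≤ z < nL + L` then
`axialRed x = x − nL e_z`. [folklore] -/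
theorem axialRed_eq_sub_of_mem_slab_int (hL : 0 < L) (n : ℤ) {x : ℝ³} (h0 : (n : ℝ) * L ≤ x 2)
    (h1 : x 2 < (n : ℝ) * L + L) : axialRed L x = x - ((n : ℝ) * L) • eZ := by
  have hfloor : ⌊x 2 / L⌋ = n := by
    rw [Int.floor_eq_iff]
    constructor
    · rw [le_div_iff₀ hL]; exact h0
    · rw [div_lt_iff₀ hL]; linarith
  show x - ((⌊x 2 / L⌋ : ℝ) * L) • eZ = x - ((n : ℝ) * L) • eZ
  rw [hfloor]

/-- **A.e. statements on the cell pass to the periodic extension**: if `p` holds a.e. on the cell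
then `p (axialRed x)` holds for a.e. `x` in the infinite open cylinder `{r < 1}` (the reduction is
a translation on each slab, translations preserve Lebesgue measure, and the seams `z ∈ Lℤ` are
null). [folklore] -/
theorem ae_comp_axialRed_of_ae_cell (hL : 0 < L) {p : ℝ³ → Prop}
    (hp : ∀ᵐ y ∂(volume.restrict (cylinderCell L : Set ℝ³)), p y) :
    ∀ᵐ x ∂(volume : Measure ℝ³), cylRadius x < 1 → p (axialRed L x) := by
  have hnull : volume {y : ℝ³ | y ∈ (cylinderCell L : Set ℝ³) ∧ ¬ p y} = 0 := by
    rw [ae_restrict_iff' (cylinderCell L).isOpen.measurableSet, ae_iff] at hp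
    have e : {y : ℝ³ | y ∈ (cylinderCell L : Set ℝ³) ∧ ¬ p y} = {y : ℝ³ | ¬ (y ∈ (cylinderCell L : Set ℝ³) → p y)} := by
      ext y; simp only [mem_setOf_eq, Classical.not_imp]
    rw [e]; exact hp
  set S₁ : Set ℝ³ := ⋃ n : ℤ, (fun x : ℝ³ => x - ((n : ℝ) * L) • eZ) ⁻¹' {y : ℝ³ | y ∈ (cylinderCell L : Set ℝ³) ∧ ¬ p y}
    with hS₁
  set S₂ : Set ℝ³ := ⋃ n : ℤ, {x : ℝ³ | x 2 = (n : ℝ) * L} with hS₂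
  have hS₁0 : volume S₁ = 0 := measure_iUnion_null fun n =>
    (measurePreserving_sub_right volume (((n : ℝ) * L) • eZ)).preimage_null hnull
  have hS₂0 : volume S₂ = 0 := measure_iUnion_null fun n => volume_setOf_apply_two_eq _
  rw [ae_iff]
  refine measure_mono_null (fun x hx => ?_) (measure_union_null hS₁0 hS₂0)
  simp only [mem_setOf_eq, Classical.not_imp] at hx
  obtain ⟨hr, hpx⟩ := hx
  set n : ℤ := ⌊x 2 / L⌋ with hn
  have h0 : (n : ℝ) * L ≤ x 2 := by
    have := Int.floor_le (x 2 / L); rw [← hn] at this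
    rwa [le_div_iff₀ hL] at this
  have h1 : x 2 < (n : ℝ) * L + L := by
    have := Int.lt_floor_add_one (x 2 / L); rw [← hn] at this
    rw [div_lt_iff₀ hL] at this; linarith
  have hred : axialRed L x = x - ((n : ℝ) * L) • eZ := axialRed_eq_sub_of_mem_slab_int hL n h0 h1
  by_cases hseam : x 2 = (n : ℝ) * L
  · exact Or.inr (mem_iUnion.2 ⟨n, hseam⟩)
  · refine Or.inl (mem_iUnion.2 ⟨n, ?_⟩)
    show x - ((n : ℝ) * L) • eZ ∈ {y : ℝ³ | y ∈ (cylinderCell L : Set ℝ³) ∧ ¬ p y}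
    rw [← hred]
    refine ⟨?_, hpx⟩
    rw [SetLike.mem_coe, mem_cylinderCell, cylRadius_axialRed, hred]
    simp only [PiLp.sub_apply, smul_eZ_apply_two]
    exact ⟨hr, sub_pos.2 (lt_of_le_of_ne h0 (Ne.symm hseam)), by linarith⟩

/-! ### The smooth periodic representative -/

/-- **The weak Neumann potential has a representative smooth on the closed cylinder and
`L`-periodic**: for smooth `L`-periodic data (`∫_cell h₀ = 0`) there is `q̂` with
`IsSmoothPeriodic L q̂`, `q = q̂` a.e. on the cell, and `∇q = cylGrad q̂` a.e. on the cell
(Kato–Lai §4 (i): the Neumann problem has smooth solutions for smooth data). [folklore] -/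
theorem exists_isSmoothPeriodic_potential (hL : 0 < L) {h₀ : ℝ³ → ℝ} {h₁ : ℝ³ → ℝ³}
    (hh₀ : IsSmoothPeriodic L h₀) (hh₁ : IsSmoothPeriodic L h₁)
    (hmean : ∫ x in (cylinderCell L : Set ℝ³), h₀ x = 0) :
    ∃ qhat : ℝ³ → ℝ, IsSmoothPeriodic L qhat ∧
      (((potential (neumannGrad L (toCell L h₀) (toCell L h₁)) : Lp ℝ 2 (cellMeasure L)) : ℝ³ → ℝ) =ᵐ[
        cellMeasure L] qhat) ∧
      (((((neumannGrad L (toCell L h₀) (toCell L h₁) : gradSpace L) : Lp ℝ³ 2 (cellMeasure L)) : ℝ³ → ℝ³)) =ᵐ[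
        cellMeasure L] cylGrad qhat) := by
  set q : ℝ³ → ℝ := ((potential (neumannGrad L (toCell L h₀) (toCell L h₁)) : Lp ℝ 2 (cellMeasure L)) : ℝ³ → ℝ)
    with hq
  -- the two representatives on the closed cell: for the data and for the data shifted by half a period
  obtain ⟨f₀, hf₀c, hf₀s, hqf₀, -⟩ := exists_smooth_rep_potential_cell hL hh₀ hh₁ hmean
  set a : ℝ := L / 2 with ha
  set k₀ : ℝ³ → ℝ := fun x => h₀ (x + a • eZ) with hk₀
  set k₁ : ℝ³ → ℝ³ := fun x => h₁ (x + a • eZ) with hk₁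
  have hk₀s : IsSmoothPeriodic L k₀ := hh₀.comp_add_smul_eZ a
  have hk₁s : IsSmoothPeriodic L k₁ := hh₁.comp_add_smul_eZ a
  have hkmean : ∫ x in (cylinderCell L : Set ℝ³), k₀ x = 0 := by
    simp only [hk₀]
    rw [integral_comp_add_smul_eZ hL a hh₀.periodic hh₀.memLp.1, hmean]
  obtain ⟨f₁, hf₁c, hf₁s, hqf₁, -⟩ := exists_smooth_rep_potential_cell hL hk₀s hk₁s hkmean
  obtain ⟨hcovq, -⟩ := potential_shiftedData_ae_eq hL a hh₀ hh₁
  -- the candidate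
  set Q : ℝ³ → ℝ := fun x => q (axialRed L x) with hQ
  set qhat : ℝ³ → ℝ := fun x => f₀ (axialRed L x) with hqhat
  set F₁ : ℝ³ → ℝ := fun x => f₁ (axialRed L (x - a • eZ)) with hF₁
  have hQp : IsAxiallyPeriodic L Q := fun x => by
    change q (axialRed L (x + L • eZ)) = q (axialRed L x); rw [axialRed_add_period hL x]
  -- (1) `Q = qhat` a.e. on the infinite open cylinder
  have hae₀ : ∀ᵐ x ∂(volume : Measure ℝ³), cylRadius x < 1 → Q x = qhat x :=
    ae_comp_axialRed_of_ae_cell hL (p := fun y => q y = f₀ y) hqf₀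
  -- (2) `Q = F₁` a.e. on the infinite open cylinder
  have hae₁ : ∀ᵐ x ∂(volume : Measure ℝ³), cylRadius x < 1 → Q x = F₁ x := by
    -- on the cell: `q₁ y = Q (y + a e_z)` and `q₁ y = f₁ y`
    have hcell : ∀ᵐ y ∂(volume.restrict (cylinderCell L : Set ℝ³)), Q (y + a • eZ) = f₁ y := by
      filter_upwards [hcovq, hqf₁] with y hy1 hy2
      rw [← hy2, hy1, cellShift_apply]
    have h1 : ∀ᵐ x ∂(volume : Measure ℝ³), cylRadius x < 1 → Q (axialRed L x + a • eZ) = f₁ (axialRed L x) :=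
      ae_comp_axialRed_of_ae_cell hL (p := fun y => Q (y + a • eZ) = f₁ y) hcell
    -- `Q (axialRed x + a e_z) = Q (x + a e_z)` by periodicity
    have h2 : ∀ᵐ x ∂(volume : Measure ℝ³), cylRadius x < 1 → Q (x + a • eZ) = f₁ (axialRed L x) := by
      filter_upwards [h1] with x hx hr
      rw [← hx hr]
      have e : x + a • eZ = (axialRed L x + a • eZ) + ((⌊x 2 / L⌋ : ℝ) * L) • eZ := by
        show x + a • eZ = (x - ((⌊x 2 / L⌋ : ℝ) * L) • eZ + a • eZ) + ((⌊x 2 / L⌋ : ℝ) * L) • eZ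
        abel
      rw [e, hQp.add_int_mul_smul_eZ]
    -- shift the variable by `−a e_z`
    have hmp : MeasurePreserving (fun x : ℝ³ => x - a • eZ) volume volume := measurePreserving_sub_right volume _
    have h3 := (hmp.quasiMeasurePreserving).ae h2
    filter_upwards [h3] with x hx hr
    have hr' : cylRadius (x - a • eZ) < 1 := by rwa [sub_eq_add_neg, ← neg_smul, cylRadius_add_smul_eZ]
    have := hx hr'
    rw [sub_add_cancel] at this
    exact this
  -- (3) continuity of the translates and smoothness within the closed cylinder
  have hK : ∀ {x : ℝ³}, x ∈ 𝕂 ↔ cylRadius x ≤ 1 := fun {x} => by rw [closure_unitCylinder]; rfl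
  -- smoothness within `𝕂` of a translate of a function smooth on the closed cell, at a point whose
  -- translate has height in `(0, L)`
  have hpiece : ∀ {f : ℝ³ → ℝ}, ContDiffOn ℝ ∞ f (closure (cylinderCell L : Set ℝ³)) →
      ∀ (c : ℝ) (x : ℝ³), x ∈ 𝕂 → 0 < (x - c • eZ) 2 → (x - c • eZ) 2 < L →
        ContDiffWithinAt ℝ ∞ (fun y => f (y - c • eZ)) 𝕂 x := by
    intro f hf c x hx h0 h1
    set v : ℝ³ := c • eZ with hv
    have hc2 : Continuous fun y : ℝ³ => (y - v) 2 := (EuclideanSpace.proj (2 : Fin 3)).continuous.comp (continuous_id.sub continuous_const)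
    set U : Set ℝ³ := {y : ℝ³ | 0 < (y - v) 2 ∧ (y - v) 2 < L} with hU
    have hUo : IsOpen U := (isOpen_lt continuous_const hc2).inter (isOpen_lt hc2 continuous_const)
    have hxU : x ∈ U := ⟨h0, h1⟩
    have hmaps : MapsTo (fun y : ℝ³ => y - v) (𝕂 ∩ U) (closure (cylinderCell L : Set ℝ³)) := by
      intro y hy
      refine subset_closure_cylinderCell' hL ⟨?_, hy.2.1.le, hy.2.2.le⟩
      have hry : cylRadius (y - v) = cylRadius y := by
        rw [hv, sub_eq_add_neg, ← neg_smul, cylRadius_add_smul_eZ]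
      rw [hry]; exact hK.1 hy.1
    have hin : ContDiffWithinAt ℝ ∞ (fun y => f (y - v)) (𝕂 ∩ U) x :=
      (hf (x - v) (hmaps ⟨hx, hxU⟩)).comp x (contDiffWithinAt_id.sub contDiffWithinAt_const) hmaps
    exact (contDiffWithinAt_inter (hUo.mem_nhds hxU)).1 hin
  refine ⟨qhat, ⟨?_, fun x => by
      change f₀ (axialRed L (x + L • eZ)) = f₀ (axialRed L x); rw [axialRed_add_period hL x]⟩, ?_, ?_⟩
  · -- smoothness on the closed cylinder
    intro x hx
    set n : ℤ := ⌊x 2 / L⌋ with hn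
    have h0 : (n : ℝ) * L ≤ x 2 := by
      have := Int.floor_le (x 2 / L); rw [← hn] at this
      rwa [le_div_iff₀ hL] at this
    have h1 : x 2 < (n : ℝ) * L + L := by
      have := Int.lt_floor_add_one (x 2 / L); rw [← hn] at this
      rw [div_lt_iff₀ hL] at this; linarith
    have hc2 : Continuous fun y : ℝ³ => y 2 := (EuclideanSpace.proj (2 : Fin 3)).continuous
    rcases h0.lt_or_eq with hpos | hseam
    · -- off the seams: `qhat = f₀ (· − nL e_z)` near `x`
      set v : ℝ³ := ((n : ℝ) * L) • eZ with hv
      have hv2 : ∀ y : ℝ³, (y - v) 2 = y 2 - (n : ℝ) * L := fun y => by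
        simp only [hv, PiLp.sub_apply, smul_eZ_apply_two]
      have hsm : ContDiffWithinAt ℝ ∞ (fun y => f₀ (y - v)) 𝕂 x :=
        hpiece hf₀s ((n : ℝ) * L) x hx (by rw [hv2]; linarith) (by rw [hv2]; linarith)
      set U : Set ℝ³ := {y : ℝ³ | (n : ℝ) * L < y 2 ∧ y 2 < (n : ℝ) * L + L} with hU
      have hUo : IsOpen U := (isOpen_lt continuous_const hc2).inter (isOpen_lt hc2 continuous_const)
      have hxU : x ∈ U := ⟨hpos, h1⟩
      have heq : ∀ y ∈ U, qhat y = f₀ (y - v) := fun y hy => by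
        show f₀ (axialRed L y) = f₀ (y - v)
        rw [axialRed_eq_sub_of_mem_slab_int hL n hy.1.le hy.2]
      refine hsm.congr_of_eventuallyEq ?_ (heq x hxU)
      exact mem_of_superset (mem_nhdsWithin_of_mem_nhds (hUo.mem_nhds hxU)) fun y hy => heq y hy
    · -- at a seam `x 2 = nL`: `qhat = f₁ (· − a e_z − (n−1)L e_z)` on a neighbourhood within `𝕂`
      set v : ℝ³ := (a + ((n : ℝ) - 1) * L) • eZ with hv
      have hv2 : ∀ y : ℝ³, (y - v) 2 = y 2 - L / 2 - ((n : ℝ) - 1) * L := fun y => by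
        simp only [hv, ha, PiLp.sub_apply, smul_eZ_apply_two]; ring
      have hsm : ContDiffWithinAt ℝ ∞ (fun y => f₁ (y - v)) 𝕂 x :=
        hpiece hf₁s (a + ((n : ℝ) - 1) * L) x hx (by rw [hv2, ← hseam]; linarith) (by rw [hv2, ← hseam]; linarith)
      -- `F₁ = f₁ (· − v)` on the slab `|z − nL| < L/4`
      set U : Set ℝ³ := {y : ℝ³ | (n : ℝ) * L - L / 4 < y 2 ∧ y 2 < (n : ℝ) * L + L / 4} with hU
      have hUo : IsOpen U := (isOpen_lt continuous_const hc2).inter (isOpen_lt hc2 continuous_const)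
      have hxU : x ∈ U := ⟨by rw [← hseam]; linarith, by rw [← hseam]; linarith⟩
      have hF₁U : ∀ y ∈ U, F₁ y = f₁ (y - v) := fun y hy => by
        show f₁ (axialRed L (y - a • eZ)) = f₁ (y - v)
        have hy2 : (y - a • eZ) 2 = y 2 - L / 2 := by simp only [ha, PiLp.sub_apply, smul_eZ_apply_two]
        rw [axialRed_eq_sub_of_mem_slab_int hL (n - 1) (by rw [hy2]; push_cast; linarith [hy.1])
          (by rw [hy2]; push_cast; linarith [hy.2])]
        congr 1
        rw [hv, sub_sub, ← add_smul]
        push_cast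
        ring_nf
      -- the two one-sided descriptions of `qhat` and their agreement with `f₁ (· − v)`
      have hside : ∀ (m : ℤ) (α β : ℝ), (m : ℝ) * L ≤ α → β ≤ (m : ℝ) * L + L → α < β →
          {y : ℝ³ | cylRadius y < 1 ∧ α < y 2 ∧ y 2 < β} ⊆ U →
          EqOn (fun y => f₀ (y - ((m : ℝ) * L) • eZ)) (fun y => f₁ (y - v))
            {y : ℝ³ | cylRadius y ≤ 1 ∧ y 2 ∈ Icc α β} := by
        intro m α β hα hβ hαβ hOU
        set O : Set ℝ³ := {y : ℝ³ | cylRadius y < 1 ∧ α < y 2 ∧ y 2 < β} with hO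
        have hOo : IsOpen O := (isOpen_lt continuous_cylRadius continuous_const).inter
          ((isOpen_lt continuous_const hc2).inter (isOpen_lt hc2 continuous_const))
        -- on `O`: `qhat = f₀ (· − mL e_z)`, and both `qhat`, `F₁` are a.e. equal to `Q`
        have hq0 : ∀ y ∈ O, qhat y = f₀ (y - ((m : ℝ) * L) • eZ) := fun y hy => by
          show f₀ (axialRed L y) = _
          rw [axialRed_eq_sub_of_mem_slab_int hL m (by linarith [hy.2.1]) (by linarith [hy.2.2])]
        have hOm : MeasurableSet O := hOo.measurableSet
        have hae : (fun y => f₀ (y - ((m : ℝ) * L) • eZ)) =ᵐ[volume.restrict O] fun y => f₁ (y - v) := by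
          rw [EventuallyEq, ae_restrict_iff' hOm]
          filter_upwards [hae₀, hae₁] with y hy0 hy1 hyO
          rw [← hq0 y hyO, ← hy0 hyO.1, hy1 hyO.1, hF₁U y (hOU hyO)]
        have hEq : EqOn (fun y => f₀ (y - ((m : ℝ) * L) • eZ)) (fun y => f₁ (y - v)) O :=
          Measure.eqOn_open_of_ae_eq hae hOo ((hf₀c.comp (continuous_id.sub continuous_const)).continuousOn)
            ((hf₁c.comp (continuous_id.sub continuous_const)).continuousOn)
        have hcl := hEq.closure (hf₀c.comp (continuous_id.sub continuous_const)) (hf₁c.comp (continuous_id.sub continuous_const))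
        exact fun y hy => hcl (subset_closure_slabCylinder hαβ hy)
      have heq : ∀ y ∈ 𝕂 ∩ U, qhat y = f₁ (y - v) := by
        rintro y ⟨hyK, hyU⟩
        have hry : cylRadius y ≤ 1 := hK.1 hyK
        rcases le_or_gt ((n : ℝ) * L) (y 2) with hge | hlt
        · -- upper side: slab `[nL, nL + L/4]`, reduction by `nL`
          have e1 : qhat y = f₀ (y - ((n : ℝ) * L) • eZ) := by
            show f₀ (axialRed L y) = _
            rw [axialRed_eq_sub_of_mem_slab_int hL n hge (by linarith [hyU.2])]
          rw [e1]
          exact hside n ((n : ℝ) * L) ((n : ℝ) * L + L / 4) le_rfl (by linarith) (by linarith)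
            (fun z hz => ⟨by linarith [hz.2.1], hz.2.2⟩) ⟨hry, hge, hyU.2.le⟩
        · -- lower side: slab `[nL − L/4, nL]`, reduction by `(n−1)L`
          have e1 : qhat y = f₀ (y - (((n - 1 : ℤ) : ℝ) * L) • eZ) := by
            show f₀ (axialRed L y) = _
            rw [axialRed_eq_sub_of_mem_slab_int hL (n - 1) (by push_cast; linarith [hyU.1]) (by push_cast; linarith)]
          rw [e1]
          exact hside (n - 1) ((n : ℝ) * L - L / 4) ((n : ℝ) * L) (by push_cast; linarith) (by push_cast; linarith)
            (by linarith) (fun z hz => ⟨hz.2.1, by linarith [hz.2.2]⟩) ⟨hry, hyU.1.le, hlt.le⟩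
      refine hsm.congr_of_eventuallyEq ?_ (heq x ⟨hx, hxU⟩)
      exact mem_of_superset (inter_mem_nhdsWithin 𝕂 (hUo.mem_nhds hxU)) fun y hy => heq y ⟨hy.1, hy.2⟩
  · -- `q = qhat` a.e. on the cell
    have h2 : ∀ᵐ x ∂(cellMeasure L), x ∈ (cylinderCell L : Set ℝ³) := ae_restrict_mem (cylinderCell L).isOpen.measurableSet
    filter_upwards [hqf₀, h2] with x hx1 hx2
    change ((potential (neumannGrad L (toCell L h₀) (toCell L h₁)) : Lp ℝ 2 (cellMeasure L)) : ℝ³ → ℝ) x = f₀ (axialRed L x)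
    rw [hx1, axialRed_eq_self_of_mem_cell hL hx2]
  · -- `∇q = cylGrad qhat` a.e. on the cell
    have hqhat_cell : ContDiffOn ℝ ∞ qhat (cylinderCell L : Set ℝ³) := by
      refine (hf₀s.mono subset_closure).congr fun x hx => ?_
      show f₀ (axialRed L x) = f₀ x
      rw [axialRed_eq_self_of_mem_cell hL hx]
    have hqq : q =ᵐ[volume.restrict (cylinderCell L : Set ℝ³)] qhat := by
      have h2 : ∀ᵐ x ∂(cellMeasure L), x ∈ (cylinderCell L : Set ℝ³) := ae_restrict_mem (cylinderCell L).isOpen.measurableSet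
      filter_upwards [hqf₀, h2] with x hx1 hx2
      change ((potential (neumannGrad L (toCell L h₀) (toCell L h₁)) : Lp ℝ 2 (cellMeasure L)) : ℝ³ → ℝ) x = f₀ (axialRed L x)
      rw [hx1, axialRed_eq_self_of_mem_cell hL hx2]
    have hG := coe_neumannGrad_ae_eq_gradient hL (Ω' := cylinderCell L) le_rfl hqhat_cell hqq
    have h2 : ∀ᵐ x ∂(cellMeasure L), x ∈ (cylinderCell L : Set ℝ³) := ae_restrict_mem (cylinderCell L).isOpen.measurableSet
    filter_upwards [hG, h2] with x hx hxc
    rw [hx]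
    -- `gradient qhat x = cylGrad qhat x` at the interior point `x`
    have hxU : x ∈ (unitCylinder : Set ℝ³) := cylinderCell_le_unitCylinder L hxc
    refine ext_inner_left ℝ fun v => ?_
    rw [inner_cylGrad_right, fderivWithin_of_mem_nhds (closure_unitCylinder_mem_nhds hxU), gradient,
      real_inner_comm, InnerProductSpace.toDual_symm_apply]

end PeriodicCylinder

end Literature.Analysis.FluidPDE
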